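import Summits.QuantumFields.YangMills.Theorems.ColdStartUniversalityLatticeLangevinWilsonEntropyDecayLaw
import Literature.MathematicalPhysics.QuantumFieldTheory.Balaban1983to89.T4TreeGaugeHolonomyLaw
import Literature.MathematicalPhysics.QuantumFieldTheory.Balaban1983to89.T4GenFunBounds
import Mathlib.InformationTheory.KullbackLeibler.Basic
import HarnessLib

/-!
# Route `ColdStartUniversality`, crux K_A1 `UniformColdStartMixing` (stmt-QuantumFields-24809, aside; ⇒ `NeutralColdStartMixing` 27363),
# LINE 4 «cold_entropy»: ★★ the registered XL stub `stub_entropyDissipation` FROM A K-UNIFORM LOG-SOBOLEV INEQUALITY IN PHYSICAL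
# UNITS — the named sufficient input of the stub's docstring, now kernel-checked

Helper file (seat `ym-line-csu-p1`, g21; `--supports stmt-QuantumFields-24809`).  The skeleton `Lines_cold_entropy.lean` (planner
ym-idea-5 g5) rests the crux on `stub_coldEntropyBudget` (K-uniform entropy budget) and `stub_entropyDissipation` (K-uniform entropy
dissipation along cold starts), the latter «(… a K-uniform log-Sobolev inequality for `μ_K` in PHYSICAL time, `T = c_LS·log(H₀/η)`, is the
named sufficient input …)».  THIS FILE proves that implication:

* `klDiv_map_eq_of_measurableEmbedding` — `KL` is invariant under measurable embeddings (Bałaban's bond dictionary);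
* `klDiv_dirac_gibbsMeasure` — `KL(δ_y ‖ gibbs_K) = ∞` (Haar on `SU(2)` charges no point): the time-`0` cold-start law has infinite
  entropy, so the stub's hypothesis at `t₀ = 0` is void;
* ★★ `entropyDissipation_of_uniformLogSobolev` — (ULS) a K-uniform generator-form log-Sobolev inequality in physical units,
  `c ε_K Ent_{μ_K}(F²) ≤ −∫ F 𝓛_K f dμ_K` on `C³` cylinders for all `K ≥ K₀` ⟹ the statement of `stub_entropyDissipation`, with
  `T = max(1, log(H₀/η)/(4c))`: at each cut-off `KL(law(U_s) ‖ μ_K) ≤ e^{−4c(s − t₀)} KL(law(U_{t₀}) ‖ μ_K)`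
  (`klDiv_map_le_exp_of_generatorLogSobolev`, i.e. BGL Thm 5.2.1 for the SZZ dynamics, g21);
  The statement is the skeleton's `EntropyDissipation` VERBATIM with its local abbreviations unfolded (this file stays outside the
  route cone); the by-name corollaries `(ULS) → stub_entropyDissipation` and `(ULS) + stub_coldEntropyBudget → UniformColdStartMixing`
  are the two-line sequel `…UniformColdStartMixingOfLogSobolevStub`.  ENTROPY twin of g18's `UniformColdStartMixing_of_uniformGeneratorPoincare`
  ((G) Poincaré + χ² budget): log-Sobolev is stronger than Poincaré, the entropy budget weaker than the χ² budget (`KL ≤ log(1 + χ²)`).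

THEOREMS ONLY, no definition, no sorry.  HONEST FRAMING: a RESHAPING of LINE 4 for the planner of record — the XL stub
`stub_entropyDissipation` is reduced to the textbook-named K-uniform log-Sobolev inequality (ULS), which is OPEN (it is the lattice-YM₃
analogue of Bauerschmidt–Dagallier's `ε`-uniform LSI and at least as hard as the crux); (ULS) holds at each FIXED cut-off with a
cut-off-dependent constant (Holley–Stroock, worthless uniformly); item 24809 is ASIDE and not restated; nothing K-uniform is proved;
no crux, rung or summit statement is proved; the Yang–Mills mass gap is NOT proved.
-/

set_option autoImplicit false

noncomputable section

namespace Summit.QuantumFields.YangMills.Theorems.ColdStartUniversality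

open MeasureTheory ProbabilityTheory InformationTheory Filter Set
open scoped BigOperators NNReal ENNReal
open Literature.Probability.Process Literature.MathematicalPhysics.QuantumFieldTheory
open Literature.MathematicalPhysics.QuantumLattice (fundamentalRep fundamentalLatticeRep continuous_fundamentalRep)
open Literature.MathematicalPhysics.QuantumFieldTheory.Balaban1983to89

/-! ## §1. `KL` under measurable embeddings; the Dirac law has infinite entropy -/

/-- **`KL` is invariant under measurable embeddings**: `klDiv (ν.map e) (μ.map e) = klDiv ν μ` for finite measures and a measurable
embedding `e` (`MeasurableEmbedding.rnDeriv_map`). [folklore] -/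
theorem klDiv_map_eq_of_measurableEmbedding {X Y : Type*} [MeasurableSpace X] [MeasurableSpace Y] {e : X → Y}
    (he : MeasurableEmbedding e) (ν μ : Measure X) [IsFiniteMeasure ν] [IsFiniteMeasure μ] :
    klDiv (ν.map e) (μ.map e) = klDiv ν μ := by
  by_cases hac : ν ≪ μ
  · have hac' : ν.map e ≪ μ.map e := he.absolutelyContinuous_map hac
    rw [klDiv_eq_lintegral_klFun_of_ac hac', klDiv_eq_lintegral_klFun_of_ac hac, he.lintegral_map]
    refine lintegral_congr_ae ?_
    filter_upwards [he.rnDeriv_map ν μ] with x hx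
    rw [hx]
  · have hac' : ¬ ν.map e ≪ μ.map e := by
      intro h
      apply hac
      intro A hA
      have h1 : μ.map e (e '' A) = 0 := by rw [he.map_apply, he.injective.preimage_image]; exact hA
      have h2 := h h1
      rwa [he.map_apply, he.injective.preimage_image] at h2
    rw [klDiv_of_not_ac hac, klDiv_of_not_ac hac']

/-- **A Dirac mass has infinite entropy w.r.t. Bałaban's Gibbs measure**: `klDiv (dirac y) (gibbsMeasure P β) = ∞` for the `SU(2)`
theory — `gibbsMeasure ≪ Π_b Haar` and Haar on `SU(2)` charges no point (`T4TreeGaugeHolonomyLaw.measure_singleton_haar_SU2`), so `{y}` is Gibbs-null while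
`δ_y{y} = 1`. [folklore] -/
theorem klDiv_dirac_gibbsMeasure (P : Params) (β : ℝ) (y : GaugeField P 0 (Matrix.specialUnitaryGroup (Fin 2) ℂ)) :
    klDiv (Measure.dirac y) (T4GenFunBounds.gibbsMeasure (G := Matrix.specialUnitaryGroup (Fin 2) ℂ) P β) = ∞ := by
  classical
  refine klDiv_of_not_ac fun h => ?_
  -- `{y}` is null for the product Haar measure
  haveI : Nonempty (PBond P 0) := ⟨⟨default, ⟨0, P.hd⟩⟩⟩
  obtain ⟨b₀⟩ := (inferInstance : Nonempty (PBond P 0))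
  have hpi : fieldMeasure P 0 (Matrix.specialUnitaryGroup (Fin 2) ℂ)
      (Set.pi univ fun b => ({y b} : Set (Matrix.specialUnitaryGroup (Fin 2) ℂ))) = 0 := by
    change Measure.pi (fun _ : PBond P 0 => (HaarData.haar : Measure (Matrix.specialUnitaryGroup (Fin 2) ℂ)))
      (Set.pi univ fun b => ({y b} : Set (Matrix.specialUnitaryGroup (Fin 2) ℂ))) = 0
    rw [Measure.pi_pi]
    exact Finset.prod_eq_zero (Finset.mem_univ b₀) (T4TreeGaugeHolonomyLaw.measure_singleton_haar_SU2 (y b₀))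
  have hsub : ({y} : Set (GaugeField P 0 (Matrix.specialUnitaryGroup (Fin 2) ℂ))) ⊆
      Set.pi univ fun b => ({y b} : Set (Matrix.specialUnitaryGroup (Fin 2) ℂ)) := by
    intro z hz b _
    rw [mem_singleton_iff.1 hz]
    exact mem_singleton _
  have hg : T4GenFunBounds.gibbsMeasure (G := Matrix.specialUnitaryGroup (Fin 2) ℂ) P β {y} = 0 :=
    measure_mono_null hsub (T4GenFunBounds.gibbsMeasure_absolutelyContinuous P β hpi)
  have hd : Measure.dirac y {y} = 0 := h hg
  have h1 : (1 : ℝ≥0∞) ≤ Measure.dirac y {y} := by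
    have := Measure.le_dirac_apply (a := y) (s := {y})
    rwa [indicator_of_mem (mem_singleton y), Pi.one_apply] at this
  rw [hd] at h1
  exact absurd h1 (by simp)

/-! ## §2. `stub_entropyDissipation` from a K-uniform log-Sobolev inequality in physical units -/

/-- ★★ **`stub_entropyDissipation` ⇐ (ULS)**.  If for all small `γ` there are `c > 0`, `K₀` such that for all `K ≥ K₀` the Wilson
measure `μ_K` at SZZ coupling `(γε_K)⁻¹/2` satisfies the generator-form log-Sobolev inequality
`c ε_K Ent_{μ_K}(F²) ≤ −∫ F·𝓛_K f dμ_K` for every `C³` `f` (`F = f∘coords`; i.e. log-Sobolev constant `ρ_K = c ε_K` in lattice units,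
`c` in PHYSICAL units, uniformly in `K`), then the registered stub `stub_entropyDissipation` of LINE 4 «cold_entropy» holds, with
`T = max(1, log(H₀/η)/(4c))`: for every cold-start solution at cut-off `K ≥ K₀`, `KL(law_{t₀}) ≤ H₀ ⟹ KL(law_s) ≤ η` for
`s ≥ t₀ + T` (`KL(law_s ‖ μ_K) ≤ e^{−4c(s−t₀)} KL(law_{t₀} ‖ μ_K)` at each cut-off; `t₀ = 0` is void since `KL(δ_1 ‖ μ_K) = ∞`).
[cite: BakryGentilLedoux2014, Thm 5.2.1] -/
theorem entropyDissipation_of_uniformLogSobolev :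
    (∃ γ₁ : ℝ, 0 < γ₁ ∧ ∀ (F : T3ContinuumYM3Torus.T3Family) (γ : ℝ), 0 < γ → γ ≤ γ₁ →
      ∃ c : ℝ, 0 < c ∧ ∃ K₀ : ℕ, ∀ K : ℕ, K₀ ≤ K →
        ∀ (f : (Edge 3 ((F.P K).sitesPerDir 0) × Fin 2 × Fin 2 × Bool → ℝ) → ℝ), ContDiff ℝ 3 f →
        let coords : GaugeConfig 3 ((F.P K).sitesPerDir 0) (Matrix.specialUnitaryGroup (Fin 2) ℂ) →
            (Edge 3 ((F.P K).sitesPerDir 0) × Fin 2 × Fin 2 × Bool → ℝ) :=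
          fun V q => (fun z : ℂ => if q.2.2.2 then z.im else z.re)
            ((fundamentalRep (Fin 2) (V q.1) : Matrix (Fin 2) (Fin 2) ℂ) q.2.1 q.2.2.1)
        let gen : GaugeConfig 3 ((F.P K).sitesPerDir 0) (Matrix.specialUnitaryGroup (Fin 2) ℂ) → ℝ := fun V =>
          (∑ i : Edge 3 ((F.P K).sitesPerDir 0) × Fin 2 × Fin 2 × Bool, fderiv ℝ f (coords V) (Pi.single i 1) *
              (fun z : ℂ => if i.2.2.2 then z.im else z.re)
                ((latticeLangevinDynamics (fundamentalLatticeRep 2) ((γ * (F.P K).eps)⁻¹ / 2)).drift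
                  (matrixConfig (fundamentalRep (Fin 2)) V) i.1 i.2.1 i.2.2.1) +
          1 / 2 * ∑ i : Edge 3 ((F.P K).sitesPerDir 0) × Fin 2 × Fin 2 × Bool,
            ∑ j : Edge 3 ((F.P K).sitesPerDir 0) × Fin 2 × Fin 2 × Bool,
            fderiv ℝ (fun z => fderiv ℝ f z (Pi.single i 1)) (coords V) (Pi.single j 1) *
              ∑ n : Edge 3 ((F.P K).sitesPerDir 0) × NoiseIdx 2,
                (if n.1 = i.1 then (fun z : ℂ => if i.2.2.2 then z.im else z.re)
                  ((latticeLangevinDynamics (fundamentalLatticeRep 2) ((γ * (F.P K).eps)⁻¹ / 2)).noise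
                    (matrixConfig (fundamentalRep (Fin 2)) V) i.1 n.2 i.2.1 i.2.2.1) else 0) *
                (if n.1 = j.1 then (fun z : ℂ => if j.2.2.2 then z.im else z.re)
                  ((latticeLangevinDynamics (fundamentalLatticeRep 2) ((γ * (F.P K).eps)⁻¹ / 2)).noise
                    (matrixConfig (fundamentalRep (Fin 2)) V) j.1 n.2 j.2.1 j.2.2.1) else 0))
        c * (F.P K).eps *
            ((∫ V, f (coords V) ^ 2 * Real.log (f (coords V) ^ 2)
                ∂(wilsonMeasure (d := 3) (L := (F.P K).sitesPerDir 0) (fundamentalRep (Fin 2)) ((γ * (F.P K).eps)⁻¹ / 2))) -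
              (∫ V, f (coords V) ^ 2
                ∂(wilsonMeasure (d := 3) (L := (F.P K).sitesPerDir 0) (fundamentalRep (Fin 2)) ((γ * (F.P K).eps)⁻¹ / 2))) *
                Real.log (∫ V, f (coords V) ^ 2
                  ∂(wilsonMeasure (d := 3) (L := (F.P K).sitesPerDir 0) (fundamentalRep (Fin 2)) ((γ * (F.P K).eps)⁻¹ / 2)))) ≤
          -∫ V, f (coords V) * gen V
            ∂(wilsonMeasure (d := 3) (L := (F.P K).sitesPerDir 0) (fundamentalRep (Fin 2)) ((γ * (F.P K).eps)⁻¹ / 2))) →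
    -- `EntropyDissipation` of the skeleton `Lines_cold_entropy.lean`, VERBATIM with its local abbreviations unfolded
    (∃ γ₁ : ℝ, 0 < γ₁ ∧ ∀ (F : T3ContinuumYM3Torus.T3Family) (γ : ℝ), 0 < γ → γ ≤ γ₁ →
      ∀ (H₀ η : ℝ), 0 ≤ H₀ → 0 < η →
        ∃ T : ℝ, 0 < T ∧ ∃ K₀ : ℕ, ∀ K : ℕ, K₀ ≤ K →
          ∀ (Ω : Type) (mΩ : MeasurableSpace Ω) (P : Measure Ω) (_ : IsProbabilityMeasure P)
            (W : ℝ≥0 → Ω → (Edge 3 ((F.P K).sitesPerDir 0) × NoiseIdx 2 → ℝ)) (hW : IsFlatBrownian W P)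
            (U : ℝ≥0 → Ω → GaugeConfig 3 ((F.P K).sitesPerDir 0) (Matrix.specialUnitaryGroup (Fin 2) ℂ)),
            ((∀ ω, U 0 ω = fun _ => 1) ∧
              (latticeLangevinDynamics (⟨2, fundamentalRep (Fin 2), continuous_fundamentalRep _,
                  Literature.MathematicalPhysics.QuantumLattice.fundamentalRep_injective _,
                  Literature.MathematicalPhysics.QuantumLattice.fundamentalRep_mem_unitaryGroup⟩ :
                  LatticeRep (Matrix.specialUnitaryGroup (Fin 2) ℂ)) ((γ * (F.P K).eps)⁻¹ / 2)).IsSolution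
                (fundamentalRep (Fin 2)) hW.natFiltration P W U) →
            ∀ t₀ : ℝ, 0 ≤ t₀ →
              klDiv (Measure.map (fun ω => (fun b : PBond (F.P K) 0 => U (t₀ / (F.P K).eps).toNNReal ω (b.src, b.dir) :
                  GaugeField (F.P K) 0 (Matrix.specialUnitaryGroup (Fin 2) ℂ))) P)
                (T4GenFunBounds.gibbsMeasure (F.P K)
                  ((F.scheme (ExpMeanLog.expMeanLogSU : LoopAverage (Matrix.specialUnitaryGroup (Fin 2) ℂ)) γ).β K)) ≤
                ENNReal.ofReal H₀ →
              ∀ s : ℝ, t₀ + T ≤ s →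
                klDiv (Measure.map (fun ω => (fun b : PBond (F.P K) 0 => U (s / (F.P K).eps).toNNReal ω (b.src, b.dir) :
                    GaugeField (F.P K) 0 (Matrix.specialUnitaryGroup (Fin 2) ℂ))) P)
                  (T4GenFunBounds.gibbsMeasure (F.P K)
                    ((F.scheme (ExpMeanLog.expMeanLogSU : LoopAverage (Matrix.specialUnitaryGroup (Fin 2) ℂ)) γ).β K)) ≤
                  ENNReal.ofReal η) := by
  rintro ⟨γ₁, hγ₁, hLS⟩
  refine ⟨γ₁, hγ₁, fun F γ hγ hγ1 H₀ η hH₀ hη => ?_⟩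
  obtain ⟨c, hc, K₀, hK⟩ := hLS F γ hγ hγ1
  classical
  -- the dissipation time `T = max(1, log(H₀/η)/(4c))`
  set T : ℝ := max 1 (Real.log (H₀ / η) / (4 * c)) with hT
  have hT0 : 0 < T := lt_of_lt_of_le one_pos (le_max_left _ _)
  have hexp : ∀ u : ℝ, T ≤ u → Real.exp (-(4 * c) * u) * H₀ ≤ η := by
    intro u hu
    rcases le_or_gt H₀ η with hle | hlt
    · have h1 : Real.exp (-(4 * c) * u) ≤ 1 := by
        rw [Real.exp_le_one_iff]; nlinarith [hT0]
      nlinarith [Real.exp_pos (-(4 * c) * u)]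
    · have hH : 0 < H₀ := lt_trans hη hlt
      have hlog : Real.log (H₀ / η) ≤ 4 * c * u := by
        have h := (le_max_right _ _).trans (hT.symm ▸ hu)
        rw [div_le_iff₀ (by positivity)] at h
        linarith [mul_comm u (4 * c)]
      have h1 : Real.exp (-(4 * c) * u) ≤ Real.exp (-Real.log (H₀ / η)) := Real.exp_le_exp.2 (by linarith)
      rw [Real.exp_neg, Real.exp_log (div_pos hH hη), inv_div] at h1
      calc Real.exp (-(4 * c) * u) * H₀ ≤ η / H₀ * H₀ := mul_le_mul_of_nonneg_right h1 hH.le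
        _ = η := div_mul_cancel₀ η hH.ne'
  refine ⟨T, hT0, K₀, fun K hKK Ω mΩ P hP W hW U hsol t₀ ht₀ hEnt s hs => ?_⟩
  obtain ⟨hU0, hsolU⟩ := hsol
  -- notation at cut-off `K`
  set ε : ℝ := (F.P K).eps with hεdef
  have hε : 0 < ε := (F.P K).eps_pos
  haveI : NeZero ((F.P K).sitesPerDir 0) := inferInstance
  set μW : Measure (GaugeConfig 3 ((F.P K).sitesPerDir 0) (Matrix.specialUnitaryGroup (Fin 2) ℂ)) :=
    wilsonMeasure (d := 3) (L := (F.P K).sitesPerDir 0) (fundamentalRep (Fin 2)) ((γ * ε)⁻¹ / 2) with hμW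
  haveI hμWP : IsProbabilityMeasure μW :=
    isProbabilityMeasure_wilsonMeasure (d := 3) (L := (F.P K).sitesPerDir 0) (fundamentalRep (Fin 2))
      (continuous_fundamentalRep (Fin 2)) _
  have hmU : ∀ t : ℝ≥0, Measurable (U t) := fun t => (hsolU.adapted t).mono (hW.natFiltration.le t) le_rfl
  haveI hprob : ∀ t : ℝ≥0, IsProbabilityMeasure (P.map (U t)) := fun t => Measure.isProbabilityMeasure_map (hmU t).aemeasurable
  -- the bond dictionary as a measurable equivalence
  let e : GaugeConfig 3 ((F.P K).sitesPerDir 0) (Matrix.specialUnitaryGroup (Fin 2) ℂ) ≃ᵐ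
      GaugeField (F.P K) 0 (Matrix.specialUnitaryGroup (Fin 2) ℂ) :=
    { toFun := fun V => (fun b : PBond (F.P K) 0 => V (b.src, b.dir) : GaugeField (F.P K) 0 (Matrix.specialUnitaryGroup (Fin 2) ℂ))
      invFun := fun Wf q => Wf ⟨q.1, q.2⟩
      left_inv := fun V => rfl
      right_inv := fun Wf => rfl
      measurable_toFun := measurable_pi_lambda _ fun b => measurable_pi_apply _
      measurable_invFun := measurable_pi_lambda _ fun q => measurable_pi_apply _ }
  have he : MeasurableEmbedding e := e.measurableEmbedding
  have hlaw_map : ∀ t : ℝ≥0, Measure.map (fun ω => (fun b : PBond (F.P K) 0 => U t ω (b.src, b.dir) :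
      GaugeField (F.P K) 0 (Matrix.specialUnitaryGroup (Fin 2) ℂ))) P =
      (P.map (U t)).map e := by
    intro t
    rw [Measure.map_map e.measurable (hmU t)]
    rfl
  -- Gibbs = Wilson through the dictionary
  have hβK : 0 ≤ (F.scheme (ExpMeanLog.expMeanLogSU : LoopAverage (Matrix.specialUnitaryGroup (Fin 2) ℂ)) γ).β K := F.scheme_β_nonneg _ hγ.le K
  have hG : T4GenFunBounds.gibbsMeasure (F.P K) ((F.scheme (ExpMeanLog.expMeanLogSU : LoopAverage (Matrix.specialUnitaryGroup (Fin 2) ℂ)) γ).β K) = μW.map e :=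
    gibbsMeasure_eq_map_wilsonMeasure (F.P K) hβK
  -- the case `t₀ = 0` is void: the law is a Dirac mass
  rcases ht₀.lt_or_eq with ht₀pos | ht₀zero
  swap
  · exfalso
    rw [← ht₀zero, zero_div, Real.toNNReal_zero] at hEnt
    have hconst : (fun ω => (fun b : PBond (F.P K) 0 => U 0 ω (b.src, b.dir) :
        GaugeField (F.P K) 0 (Matrix.specialUnitaryGroup (Fin 2) ℂ))) =
        fun _ => (fun b : PBond (F.P K) 0 => (1 : Matrix.specialUnitaryGroup (Fin 2) ℂ) :
        GaugeField (F.P K) 0 (Matrix.specialUnitaryGroup (Fin 2) ℂ)) := by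
      funext ω; simp only [hU0 ω]
    rw [hconst, Measure.map_const, measure_univ, one_smul] at hEnt
    have htop := klDiv_dirac_gibbsMeasure (F.P K)
      ((F.scheme (ExpMeanLog.expMeanLogSU : LoopAverage (Matrix.specialUnitaryGroup (Fin 2) ℂ)) γ).β K)
      (fun _ : PBond (F.P K) 0 => (1 : Matrix.specialUnitaryGroup (Fin 2) ℂ))
    have h2 : (⊤ : ℝ≥0∞) ≤ ENNReal.ofReal H₀ := le_of_eq_of_le htop.symm hEnt
    exact absurd h2 (by simp)
  have hKL : ∀ t : ℝ≥0, klDiv (Measure.map (fun ω => (fun b : PBond (F.P K) 0 => U t ω (b.src, b.dir) :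
      GaugeField (F.P K) 0 (Matrix.specialUnitaryGroup (Fin 2) ℂ))) P)
      (T4GenFunBounds.gibbsMeasure (F.P K) ((F.scheme (ExpMeanLog.expMeanLogSU : LoopAverage (Matrix.specialUnitaryGroup (Fin 2) ℂ)) γ).β K)) =
      klDiv (P.map (U t)) μW := by
    intro t
    rw [hlaw_map, hG]
    exact klDiv_map_eq_of_measurableEmbedding he _ _
  rw [hKL] at hEnt ⊢
  -- `t₀ > 0`: lattice times `τ₀ = t₀/ε`, `u = (s − t₀)/ε`
  have hst : T ≤ s - t₀ := by linarith
  set τ₀ : ℝ≥0 := (t₀ / ε).toNNReal with hτ₀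
  set u : ℝ≥0 := ((s - t₀) / ε).toNNReal with hu
  have hτ₀pos : 0 < (τ₀ : ℝ) := by rw [hτ₀, Real.coe_toNNReal _ (div_pos ht₀pos hε).le]; exact div_pos ht₀pos hε
  have hucoe : (u : ℝ) = (s - t₀) / ε := Real.coe_toNNReal _ (div_nonneg (by linarith) hε.le)
  have hsplit : (s / ε).toNNReal = τ₀ + u := by
    rw [hτ₀, hu, ← Real.toNNReal_add (div_pos ht₀pos hε).le (div_nonneg (by linarith) hε.le)]
    congr 1; field_simp; ring
  rw [hsplit]
  -- the log-Sobolev inequality at cut-off `K`, constant `ρ = c ε`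
  have hρ : 0 < c * ε := mul_pos hc hε
  have hdecay := klDiv_map_le_exp_of_generatorLogSobolev ((F.P K).sitesPerDir 0) ((γ * ε)⁻¹ / 2) hρ (hK K hKK) hW
    (fun _ => 1) hU0 hsolU hτ₀pos u
  refine hdecay.trans (ENNReal.ofReal_le_ofReal ?_)
  -- `e^{−4cεu} KL₀ ≤ e^{−4cT} H₀ ≤ η`
  have hKL0 : (klDiv (P.map (U τ₀)) μW).toReal ≤ H₀ := ENNReal.toReal_le_of_le_ofReal hH₀ hEnt
  have heu : Real.exp (-4 * (c * ε) * u) = Real.exp (-(4 * c) * (s - t₀)) := by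
    rw [hucoe]; congr 1; field_simp
  rw [heu]
  calc Real.exp (-(4 * c) * (s - t₀)) * (klDiv (P.map (U τ₀)) μW).toReal
      ≤ Real.exp (-(4 * c) * (s - t₀)) * H₀ := mul_le_mul_of_nonneg_left hKL0 (Real.exp_pos _).le
    _ ≤ η := hexp _ hst

end Summit.QuantumFields.YangMills.Theorems.ColdStartUniversality

end
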